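import Literature.NumberTheory.LFunctions.MoebiusWalshTypeIIZero
import HarnessLib

/-!
# Tools for the shifted-window type-II box estimate (Bourgain 2013, §2: (2.3)–(2.4) and the digit
# truncation for the lags `ℓ2^K`) — proved

Topic `Literature/NumberTheory/LFunctions`; proofs only (theorems, no definition, no named fact).
J. Bourgain, *Möbius–Walsh correlation bounds and an estimate of Mauduit and Rivat*, J. Anal. Math.
**119** (2013) 147–163 = arXiv:1109.2784 [Bourgain2013MoebiusWalsh], §2. The type-II box estimate
for the SHIFTED windows `[K, K + μ + ρ')` (the half of the per-box hypothesis `hII` of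
`LiouvilleWalshAssembly.lean` with `i ≤ K + ρ ∧ 4ρ < K`) runs: van der Corput with lags `d·2^K`
(tree `MoebiusWalsh.vdC_bilinear` with `R = 2^K`), digit truncation to the window, replacement of
`w_{S'}` by the localised `W_{S'}` of Lemma 5 in `L²` ((2.3)–(2.4)), Fourier expansion, and the
pair count (tree: `MoebiusWalsh.typeII_count_high` / `MoebiusWalshTypeIIHigh.lean`). This file
supplies the two middle steps in the vocabulary of `MoebiusWalshTypeIIZero.lean` (dyadic blocks
`dyBlock`, `natWalsh`, `walshNat`, `localisedWalshRe`):

* `sum_box_le_sqrt_mul_sqrt` — **(2.4)**: for `g ≥ 0`,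
  `∑_{a ∈ D_i} ∑_{b ∈ [B₀,B₀+N)} g(ab) ≤ √(X(1+log X)³) √(∑_{x<X} g(x)²)` (`2^{i+1}(B₀+N) ≤ X`, `B₀ ≥ 1`):
  group the pairs by the product, bound its multiplicity by `τ(x)`, Cauchy–Schwarz and the tree's
  `∑_{x≤X} τ(x)² ≤ X(1+log X)³` (`Vaughan.sum_sq_card_divisors_le`);
* `sum_box_abs_localised_sub_le` — **(2.3)–(2.4)**: with Lemma 5 (1.12) in the tree's form
  (`sum_norm_sq_localisedWalsh_sub_walshNat_le`) and periodicity (`sum_range_le_of_periodic`),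
  `∑_{a ∈ D_i} ∑_b |W_A(ab) - w_A(ab)| ≤ √(X(1+log X)³) √((⌊X/P⌋+1) P/(2(K₁-1)))`, `P = 2^{q+σ}`;
  `abs_mul_sub_mul_le_of_bounds` — the differenced product changes by `≤ |ΔW(u')|·3 + |ΔW(u)|`;
* `abs_sum_dyBlock_mul_le_trunc_shift`, `sum_card_filter_carry_le_shift` — the shifted-window
  twins of `MoebiusWalshTypeII.abs_sum_dyBlock_mul_le_trunc` / `sum_card_filter_carry_le` (lag
  `d·2^K`, window `T ∩ [K, i+ρ+1+K+t)`, exceptions `≤ 2^i(2^j/2^{ρ+K+t} + 2)(2^{ρ+K+1} + 1)` — a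
  saving only when `K + ρ + t ≤ j`);
* `natWalsh_mul_natWalsh_add_eq_fullWindow`, `sum_dyBlock_mul_eq_fullWindow` — when the window
  reaches the top digit (`T ∩ [K, i+j+2)`, all arguments `< 2^{i+j+2}`, which the van der Corput
  indicator `b + d2^K < 2^{j+1}` guarantees) the truncation is EXACT, with no exceptional set: the
  regime `K + ρ + t > j` of the shifted windows.

## References

* J. Bourgain, J. Anal. Math. 119 (2013) 147–163; arXiv:1109.2784, §2 (2.2)–(2.4), (2.23).
  [Bourgain2013MoebiusWalsh]
* C. Mauduit, J. Rivat, Ann. of Math. 171 (2010) 1591–1646, Lemme 5 (carry propagation).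
-/

noncomputable section

open Finset Real

namespace Literature.NumberTheory.LFunctions.MoebiusWalsh

open Literature.NumberTheory.LFunctions.MoebiusWalshVaughan (natWalsh dyBlock mem_dyBlock abs_natWalsh)
open Literature.NumberTheory.LFunctions.MoebiusWalshTypeII (natWalsh_mul_natWalsh_add_eq_window
  natWalsh_mul_self card_filter_carry_le card_dyBlock)

/-! ### A divisor-counting Cauchy–Schwarz on a box ((2.4)) -/

/-- **`∑_{a ∈ D_i} ∑_{b ∈ [B₀, B₀+N)} g(ab) ≤ √(X(1+log X)³) · √(∑_{x<X} g(x)²)`** for `g ≥ 0`,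
`B₀ ≥ 1` and `2^{i+1}(B₀+N) ≤ X`: group the pairs `(a, b)` by the value `x = ab < X`, bound the
multiplicity of `x` by `τ(x)`, and apply Cauchy–Schwarz with the tree's
`∑_{x ≤ X} τ(x)² ≤ X(1 + log X)³` (`Vaughan.sum_sq_card_divisors_le`). This is the step
"(2.4) `< X(∑|w_{S'} - W_{S'}|²)^{1/2}(∑ d(x)²)^{1/2}`" of Bourgain 2013.
[cite: Bourgain2013MoebiusWalsh, §2 (2.4)] -/
theorem sum_box_le_sqrt_mul_sqrt (g : ℕ → ℝ) (hg : ∀ x, 0 ≤ g x) (i : ℕ) {B₀ Nn X : ℕ}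
    (hB₀ : 1 ≤ B₀) (hX : 2 ^ (i + 1) * (B₀ + Nn) ≤ X) :
    ∑ a ∈ dyBlock i, ∑ b ∈ Ico B₀ (B₀ + Nn), g (a * b) ≤
      Real.sqrt (X * (1 + Real.log X) ^ 3) * Real.sqrt (∑ x ∈ range X, g x ^ 2) := by
  classical
  set S : Finset (ℕ × ℕ) := dyBlock i ×ˢ Ico B₀ (B₀ + Nn) with hS
  set r : ℕ → ℕ := fun x => (S.filter fun p => p.1 * p.2 = x).card with hr
  -- products are `< X` and `≥ 1`
  have hprod : ∀ p ∈ S, p.1 * p.2 < X ∧ 0 < p.1 ∧ 0 < p.2 := by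
    intro p hp
    rw [hS, Finset.mem_product, mem_dyBlock, Finset.mem_Ico] at hp
    have h1 : p.1 < 2 ^ (i + 1) := hp.1.2
    have h2 : p.2 < B₀ + Nn := hp.2.2
    refine ⟨lt_of_lt_of_le ?_ hX, lt_of_lt_of_le (Nat.two_pow_pos i) hp.1.1, by omega⟩
    calc p.1 * p.2 < 2 ^ (i + 1) * p.2.succ := by
          have := Nat.mul_lt_mul_of_lt_of_le h1 (Nat.le_succ p.2) (Nat.succ_pos _)
          linarith [Nat.mul_le_mul_left (2 ^ (i + 1)) (Nat.le_succ p.2)]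
      _ ≤ 2 ^ (i + 1) * (B₀ + Nn) := Nat.mul_le_mul_left _ (by omega)
  -- regroup by the product
  have hregroup : ∑ a ∈ dyBlock i, ∑ b ∈ Ico B₀ (B₀ + Nn), g (a * b) = ∑ x ∈ range X, (r x : ℝ) * g x := by
    rw [← Finset.sum_product (s := dyBlock i) (t := Ico B₀ (B₀ + Nn)) (f := fun p => g (p.1 * p.2)), ← hS]
    rw [← Finset.sum_fiberwise_of_maps_to (g := fun p : ℕ × ℕ => p.1 * p.2) (t := range X)
      (fun p hp => Finset.mem_range.2 (hprod p hp).1)]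
    refine Finset.sum_congr rfl fun x _ => ?_
    rw [Finset.sum_congr rfl fun p hp => by rw [(Finset.mem_filter.1 hp).2], Finset.sum_const, nsmul_eq_mul]
  -- multiplicity `≤ τ(x)`
  have hrle : ∀ x, r x ≤ x.divisors.card := by
    intro x
    refine Finset.card_le_card_of_injOn (fun p => p.1) (fun p hp => ?_) ?_
    · rw [Finset.mem_coe, Finset.mem_filter] at hp
      have h := hprod p hp.1
      rw [Finset.mem_coe, Nat.mem_divisors]
      refine ⟨Dvd.intro _ hp.2, ?_⟩
      rw [← hp.2]; exact Nat.pos_iff_ne_zero.1 (Nat.mul_pos h.2.1 h.2.2)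
    · intro p hp p' hp' heq
      rw [Finset.mem_coe, Finset.mem_filter] at hp hp'
      have h0 := (hprod p hp.1).2.1
      have : p.2 = p'.2 := by
        have e : p.1 * p.2 = p.1 * p'.2 := by rw [hp.2, ← hp'.2]; simp only at heq; rw [heq]
        exact Nat.eq_of_mul_eq_mul_left h0 e
      exact Prod.ext heq this
  -- the divisor mean square
  have hdiv : ∑ x ∈ range X, ((r x : ℝ)) ^ 2 ≤ X * (1 + Real.log X) ^ 3 := by
    have hτ := Literature.NumberTheory.Sieve.Vaughan.sum_sq_card_divisors_le X
    calc ∑ x ∈ range X, ((r x : ℝ)) ^ 2 ≤ ∑ x ∈ range X, ((x.divisors.card : ℕ) : ℝ) ^ 2 := by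
          refine Finset.sum_le_sum fun x _ => ?_
          exact pow_le_pow_left₀ (Nat.cast_nonneg _) (by exact_mod_cast hrle x) 2
      _ ≤ ∑ x ∈ Ioc 0 X, ((x.divisors.card : ℕ) : ℝ) ^ 2 := by
          rcases Nat.eq_zero_or_pos X with hX0 | hX0
          · subst hX0; simp
          · rw [Finset.range_eq_Ico, Finset.sum_eq_sum_Ico_succ_bot hX0]
            simp only [Nat.divisors_zero, Finset.card_empty, Nat.cast_zero, ne_eq, OfNat.ofNat_ne_zero,
              not_false_eq_true, zero_pow, zero_add]
            refine Finset.sum_le_sum_of_subset_of_nonneg (fun x hx => ?_) fun x _ _ => by positivity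
            rw [Finset.mem_Ico] at hx; rw [Finset.mem_Ioc]; omega
      _ ≤ X * (1 + Real.log X) ^ 3 := by simpa [Nat.card_eq_finsetCard] using hτ
  -- Cauchy–Schwarz
  rw [hregroup]
  have hcs := Finset.sum_mul_sq_le_sq_mul_sq (range X) (fun x => (r x : ℝ)) g
  have h0 : 0 ≤ ∑ x ∈ range X, (r x : ℝ) * g x := Finset.sum_nonneg fun x _ => mul_nonneg (Nat.cast_nonneg _) (hg x)
  calc ∑ x ∈ range X, (r x : ℝ) * g x = Real.sqrt ((∑ x ∈ range X, (r x : ℝ) * g x) ^ 2) := by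
        rw [Real.sqrt_sq h0]
    _ ≤ Real.sqrt ((∑ x ∈ range X, (r x : ℝ) ^ 2) * ∑ x ∈ range X, g x ^ 2) := Real.sqrt_le_sqrt hcs
    _ = Real.sqrt (∑ x ∈ range X, (r x : ℝ) ^ 2) * Real.sqrt (∑ x ∈ range X, g x ^ 2) :=
        Real.sqrt_mul (Finset.sum_nonneg fun x _ => by positivity) _
    _ ≤ Real.sqrt (X * (1 + Real.log X) ^ 3) * Real.sqrt (∑ x ∈ range X, g x ^ 2) :=
        mul_le_mul_of_nonneg_right (Real.sqrt_le_sqrt hdiv) (Real.sqrt_nonneg _)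

/-- A nonnegative `Q`-periodic sequence summed over `[0, X)` is at most `⌊X/Q⌋ + 1` periods. [folklore] -/
theorem sum_range_le_of_periodic {F : ℕ → ℝ} (hF : ∀ x, 0 ≤ F x) {Q : ℕ} (hQ : 0 < Q)
    (hper : ∀ x, F (x + Q) = F x) (X : ℕ) :
    ∑ x ∈ range X, F x ≤ (((X / Q : ℕ) : ℝ) + 1) * ∑ x ∈ range Q, F x := by
  set T : ℕ := X / Q + 1 with hT
  have hsub : range X ⊆ range (Q * T) := Finset.range_subset_range.2 (by
    have := Nat.lt_mul_div_succ X hQ; rw [hT]; linarith)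
  have hperm : ∀ (m k : ℕ), F (k + Q * m) = F k := by
    intro m
    induction m with
    | zero => intro k; simp
    | succ m ih => intro k; rw [Nat.mul_succ, ← add_assoc, hper, ih]
  calc ∑ x ∈ range X, F x ≤ ∑ x ∈ range (Q * T), F x :=
        Finset.sum_le_sum_of_subset_of_nonneg hsub fun x _ _ => hF x
    _ = ∑ m ∈ range T, ∑ k ∈ range Q, F (k + Q * m) := sum_range_mul_eq_sum_sum F Q T
    _ = ∑ _m ∈ range T, ∑ k ∈ range Q, F k :=
        Finset.sum_congr rfl fun m _ => Finset.sum_congr rfl fun k _ => hperm m k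
    _ = (((X / Q : ℕ) : ℝ) + 1) * ∑ x ∈ range Q, F x := by
        rw [Finset.sum_const, Finset.card_range, nsmul_eq_mul, hT]; push_cast; ring

/-! ### The `L²` replacement of `w_A` by `W_A` on a box ((2.3)–(2.4)) -/

/-- **Replacing `w_A` by its localised substitute on a box costs little** (Bourgain 2013,
(2.3)–(2.4)): for `A ⊆ {q, …, q+σ-1}`, `K₁ ≥ 2`, `4K₁ ≤ 2^q`, `W = W_A` (`localisedWalshRe`),
`w = w_A` (`walshNat`), `B₀ ≥ 1`, `2^{i+1}(B₀ + N) ≤ X`, `P = 2^{q+σ}`: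
`∑_{a ∈ D_i} ∑_{b ∈ [B₀, B₀+N)} |W(ab) - w(ab)| ≤ √(X(1+log X)³) √((⌊X/P⌋ + 1) P/(2(K₁-1)))`
(the divisor Cauchy–Schwarz `sum_box_le_sqrt_mul_sqrt`, periodicity, and Lemma 5 (1.12) in the
tree's form `sum_norm_sq_localisedWalsh_sub_walshNat_le`). [cite: Bourgain2013MoebiusWalsh, §2 (2.3)–(2.4)] -/
theorem sum_box_abs_localised_sub_le {q σ K₁ : ℕ} (A : Finset (Fin (q + σ)))
    (hA : ∀ j ∈ A, q ≤ (j : ℕ)) (hK : 2 ≤ K₁) (hKq : 4 * K₁ ≤ 2 ^ q)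
    (i : ℕ) {B₀ Nn X : ℕ} (hB₀ : 1 ≤ B₀) (hX : 2 ^ (i + 1) * (B₀ + Nn) ≤ X) :
    ∑ a ∈ dyBlock i, ∑ b ∈ Ico B₀ (B₀ + Nn), |localisedWalshRe q σ K₁ A (a * b) - walshNat A (a * b)| ≤
      Real.sqrt (X * (1 + Real.log X) ^ 3) *
        Real.sqrt ((((X / 2 ^ (q + σ) : ℕ) : ℝ) + 1) * (2 ^ (q + σ) / (2 * ((K₁ : ℝ) - 1)))) := by
  set g : ℕ → ℝ := fun x => |localisedWalshRe q σ K₁ A x - walshNat A x| with hg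
  have hg0 : ∀ x, 0 ≤ g x := fun x => abs_nonneg _
  have h1 := sum_box_le_sqrt_mul_sqrt g hg0 i hB₀ hX
  refine h1.trans (mul_le_mul_of_nonneg_left (Real.sqrt_le_sqrt ?_) (Real.sqrt_nonneg _))
  -- `∑_{x<X} g² ≤ (⌊X/P⌋+1) ∑_{x<P} g² ≤ (⌊X/P⌋+1) P/(2(K₁-1))`
  have hper : ∀ x, g (x + 2 ^ (q + σ)) ^ 2 = g x ^ 2 := by
    intro x
    simp only [hg, localisedWalshRe]
    rw [localisedWalsh_add_two_pow, walshNat_add_two_pow]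
  have h2 := sum_range_le_of_periodic (F := fun x => g x ^ 2) (fun x => by positivity) (Nat.two_pow_pos (q + σ))
    hper X
  refine h2.trans (mul_le_mul_of_nonneg_left ?_ (by positivity))
  have h3 := sum_norm_sq_localisedWalsh_sub_walshNat_le A hA hK hKq
  refine le_trans (Finset.sum_le_sum fun x _ => ?_) h3
  simp only [hg, localisedWalshRe]
  have hre : (localisedWalsh q σ K₁ A x).re - walshNat A x =
      (localisedWalsh q σ K₁ A x - (walshNat A x : ℂ)).re := by
    rw [Complex.sub_re, Complex.ofReal_re]
  rw [sq_abs, hre, ← sq_abs]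
  exact pow_le_pow_left₀ (abs_nonneg _) (Complex.abs_re_le_norm _) 2

/-- **The differenced product after the replacement**: with `|W| ≤ 3` and `|w| = 1`,
`|W(u')W(u) - w(u')w(u)| ≤ |W(u') - w(u')| + 3|W(u) - w(u)|`. [folklore] -/
theorem abs_mul_sub_mul_le_of_bounds {W₁ W₂ w₁ w₂ : ℝ} (hW₂ : |W₂| ≤ 3) (hw₁ : |w₁| = 1) :
    |W₁ * W₂ - w₁ * w₂| ≤ |W₁ - w₁| * 3 + |W₂ - w₂| := by
  have h : W₁ * W₂ - w₁ * w₂ = (W₁ - w₁) * W₂ + w₁ * (W₂ - w₂) := by ring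
  rw [h]
  calc |(W₁ - w₁) * W₂ + w₁ * (W₂ - w₂)| ≤ |(W₁ - w₁) * W₂| + |w₁ * (W₂ - w₂)| := abs_add_le _ _
    _ = |W₁ - w₁| * |W₂| + |w₁| * |W₂ - w₂| := by rw [abs_mul, abs_mul]
    _ ≤ |W₁ - w₁| * 3 + 1 * |W₂ - w₂| := by
        rw [hw₁]
        exact add_le_add (mul_le_mul_of_nonneg_left hW₂ (abs_nonneg _)) le_rfl
    _ = _ := by ring

/-! ### Digit truncation for the lags `ℓ2^K` -/

/-- **No truncation needed when the window reaches the top**: if `2^K ∣ δ` and `x + δ < 2^{Wt}`,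
then `w_T(x + δ) w_T(x) = w_{T'}(x + δ) w_{T'}(x)` with `T' = {j ∈ T : K ≤ j < Wt}` EXACTLY (the
digits below `K` agree, those `≥ Wt` vanish on both sides). [cite: Bourgain2013MoebiusWalsh, §2 (definition of S')] -/
theorem natWalsh_mul_natWalsh_add_eq_fullWindow (T : Finset ℕ) {x δ K Wt : ℕ}
    (hδ : 2 ^ K ∣ δ) (hx : x + δ < 2 ^ Wt) :
    natWalsh T (x + δ) * natWalsh T x =
      natWalsh (T.filter fun j => K ≤ j ∧ j < Wt) (x + δ) *
        natWalsh (T.filter fun j => K ≤ j ∧ j < Wt) x := by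
  set T' := T.filter fun j => K ≤ j ∧ j < Wt with hT'
  set T'' := T.filter fun j => ¬ (K ≤ j ∧ j < Wt) with hT''
  have hsplit : ∀ y, natWalsh T y = natWalsh T' y * natWalsh T'' y := by
    intro y
    unfold natWalsh
    rw [hT', hT'', Finset.prod_filter_mul_prod_filter_not]
  have hout : natWalsh T'' (x + δ) = natWalsh T'' x := by
    unfold natWalsh
    refine Finset.prod_congr rfl fun j hj => ?_
    have hj' : j < K ∨ Wt ≤ j := by
      have := (Finset.mem_filter.1 hj).2; omega
    rcases hj' with hj' | hj'
    · -- low digits: `x + δ ≡ x (mod 2^K)`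
      have h1 : (x + δ) % 2 ^ K = x % 2 ^ K := by
        obtain ⟨e, he⟩ := hδ
        rw [he, Nat.add_mul_mod_self_left]
      have h2 : ∀ y : ℕ, y.testBit j = (y % 2 ^ K).testBit j := by
        intro y; rw [Nat.testBit_mod_two_pow]; simp [hj']
      rw [h2 (x + δ), h2 x, h1]
    · -- high digits vanish on both sides
      have hx' : x < 2 ^ Wt := by omega
      rw [Nat.testBit_eq_false_of_lt (lt_of_lt_of_le hx (Nat.pow_le_pow_right (by norm_num) hj')),
        Nat.testBit_eq_false_of_lt (lt_of_lt_of_le hx' (Nat.pow_le_pow_right (by norm_num) hj'))]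
  rw [hsplit (x + δ), hsplit x, hout]
  calc natWalsh T' (x + δ) * natWalsh T'' x * (natWalsh T' x * natWalsh T'' x)
      = natWalsh T' (x + δ) * natWalsh T' x * (natWalsh T'' x * natWalsh T'' x) := by ring
    _ = natWalsh T' (x + δ) * natWalsh T' x := by rw [natWalsh_mul_self, mul_one]

/-- **One lag `d·2^K`, one `b`: truncation up to the carry exceptions** (the shifted-window twin of
`MoebiusWalshTypeII.abs_sum_dyBlock_mul_le_trunc`). For `d < 2^ρ`, `w = i + ρ + 1 + K`,
`T' = T ∩ [K, w + t)`:
`|∑_{a ∈ D_i} w_T(a(b + d2^K)) w_T(ab)| ≤ |∑_{a ∈ D_i} w_{T'}(a(b + d2^K)) w_{T'}(ab)| + 2 #{a ∈ D_i : ⌊ab/2^w⌋ ≡ -1 (2^t)}`.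
[cite: Bourgain2013MoebiusWalsh, §2 (truncation after (2.2))] -/
theorem abs_sum_dyBlock_mul_le_trunc_shift (T : Finset ℕ) (i ρ t K b : ℕ) {d : ℕ} (hd : d < 2 ^ ρ) :
    |∑ a ∈ dyBlock i, natWalsh T (a * (b + d * 2 ^ K)) * natWalsh T (a * b)| ≤
      |∑ a ∈ dyBlock i,
          natWalsh (T.filter fun j => K ≤ j ∧ j < (i + ρ + 1 + K) + t) (a * (b + d * 2 ^ K)) *
            natWalsh (T.filter fun j => K ≤ j ∧ j < (i + ρ + 1 + K) + t) (a * b)| +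
        2 * ((dyBlock i).filter fun a => (a * b / 2 ^ (i + ρ + 1 + K)) % 2 ^ t = 2 ^ t - 1).card := by
  set T' := T.filter fun j => K ≤ j ∧ j < (i + ρ + 1 + K) + t with hT'
  set F : ℕ → ℝ := fun a => natWalsh T (a * (b + d * 2 ^ K)) * natWalsh T (a * b) with hF
  set G : ℕ → ℝ := fun a => natWalsh T' (a * (b + d * 2 ^ K)) * natWalsh T' (a * b) with hG
  set Bad := (dyBlock i).filter fun a => (a * b / 2 ^ (i + ρ + 1 + K)) % 2 ^ t = 2 ^ t - 1 with hBad
  have hFG : ∀ a ∈ dyBlock i, a ∉ Bad → F a = G a := by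
    intro a ha hbad
    have hgood : (a * b / 2 ^ (i + ρ + 1 + K)) % 2 ^ t ≠ 2 ^ t - 1 := by
      intro h; exact hbad (Finset.mem_filter.2 ⟨ha, h⟩)
    have ha1 := (mem_dyBlock.1 ha).1
    have ha2 := (mem_dyBlock.1 ha).2
    have ha0 : 0 < a := lt_of_lt_of_le (Nat.two_pow_pos i) ha1
    have hδ : a * d * 2 ^ K < 2 ^ (i + ρ + 1 + K) := by
      calc a * d * 2 ^ K < a * 2 ^ ρ * 2 ^ K := by
            have : a * d < a * 2 ^ ρ := mul_lt_mul_of_pos_left hd ha0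
            exact Nat.mul_lt_mul_of_lt_of_le this le_rfl (Nat.two_pow_pos K)
        _ ≤ 2 ^ (i + 1) * 2 ^ ρ * 2 ^ K := by gcongr
        _ = 2 ^ (i + ρ + 1 + K) := by rw [← pow_add, ← pow_add]; ring_nf
    have hdvd : 2 ^ K ∣ a * d * 2 ^ K := Dvd.intro_left _ rfl
    simp only [hF, hG]
    rw [show a * (b + d * 2 ^ K) = a * b + a * d * 2 ^ K by ring]
    exact natWalsh_mul_natWalsh_add_eq_window T hdvd hδ hgood
  have hdiff : ∀ a ∈ dyBlock i, |F a - G a| ≤ if a ∈ Bad then 2 else 0 := by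
    intro a ha
    split_ifs with hbad
    · calc |F a - G a| ≤ |F a| + |G a| := abs_sub _ _
        _ ≤ 1 + 1 := by
            simp only [hF, hG]
            rw [abs_mul, abs_mul, abs_natWalsh, abs_natWalsh, abs_natWalsh, abs_natWalsh]; norm_num
        _ = 2 := by norm_num
    · rw [hFG a ha hbad, sub_self, abs_zero]
  calc |∑ a ∈ dyBlock i, F a| = |∑ a ∈ dyBlock i, G a + ∑ a ∈ dyBlock i, (F a - G a)| := by
        rw [← Finset.sum_add_distrib]; congr 1; refine Finset.sum_congr rfl fun a _ => by ring
    _ ≤ |∑ a ∈ dyBlock i, G a| + |∑ a ∈ dyBlock i, (F a - G a)| := abs_add_le _ _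
    _ ≤ |∑ a ∈ dyBlock i, G a| + ∑ a ∈ dyBlock i, |F a - G a| :=
        add_le_add le_rfl (Finset.abs_sum_le_sum_abs _ _)
    _ ≤ |∑ a ∈ dyBlock i, G a| + ∑ a ∈ dyBlock i, (if a ∈ Bad then (2 : ℝ) else 0) :=
        add_le_add le_rfl (Finset.sum_le_sum hdiff)
    _ = |∑ a ∈ dyBlock i, G a| + 2 * (Bad.card : ℝ) := by
        rw [Finset.sum_ite_mem, Finset.sum_const, nsmul_eq_mul]
        congr 1
        rw [show dyBlock i ∩ Bad = Bad from Finset.inter_eq_right.2 (Finset.filter_subset _ _)]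
        ring

/-- **One lag `d·2^K`, one `b`, top window: no exceptions.** If `b + d2^K < 2^{j+1}` then
for `T' = T ∩ [K, i + j + 2)`,
`∑_{a ∈ D_i} w_T(a(b + d2^K)) w_T(ab) = ∑_{a ∈ D_i} w_{T'}(a(b + d2^K)) w_{T'}(ab)`.
[cite: Bourgain2013MoebiusWalsh, §2 (definition of S')] -/
theorem sum_dyBlock_mul_eq_fullWindow (T : Finset ℕ) (i j K b d : ℕ) (hb : b + d * 2 ^ K < 2 ^ (j + 1)) :
    ∑ a ∈ dyBlock i, natWalsh T (a * (b + d * 2 ^ K)) * natWalsh T (a * b) =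
      ∑ a ∈ dyBlock i, natWalsh (T.filter fun x => K ≤ x ∧ x < i + j + 2) (a * (b + d * 2 ^ K)) *
        natWalsh (T.filter fun x => K ≤ x ∧ x < i + j + 2) (a * b) := by
  refine Finset.sum_congr rfl fun a ha => ?_
  have ha2 := (mem_dyBlock.1 ha).2
  have hx : a * b + a * d * 2 ^ K < 2 ^ (i + j + 2) := by
    calc a * b + a * d * 2 ^ K = a * (b + d * 2 ^ K) := by ring
      _ < 2 ^ (i + 1) * 2 ^ (j + 1) := Nat.mul_lt_mul'' ha2 hb
      _ = 2 ^ (i + j + 2) := by rw [← pow_add]; ring_nf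
  rw [show a * (b + d * 2 ^ K) = a * b + a * d * 2 ^ K by ring]
  exact natWalsh_mul_natWalsh_add_eq_fullWindow T (Dvd.intro_left _ rfl) hx

/-- **The carry exceptions in a whole box, lags `ℓ2^K`**: for `w = i + ρ + 1 + K`,
`∑_{b ∈ D_j} #{a ∈ D_i : ⌊ab/2^w⌋ ≡ -1 (2^t)} ≤ 2^i (2^j/2^{ρ+K+t} + 2)(2^{ρ+K+1} + 1)`.
[cite: Bourgain2013MoebiusWalsh, §2 (error term after (2.2))] -/
theorem sum_card_filter_carry_le_shift (i j ρ t K : ℕ) :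
    ∑ b ∈ dyBlock j, ((((dyBlock i).filter fun a => (a * b / 2 ^ (i + ρ + 1 + K)) % 2 ^ t = 2 ^ t - 1).card : ℕ) : ℝ) ≤
      2 ^ i * (((2 : ℝ) ^ j / 2 ^ (ρ + K + t) + 2) * (2 ^ (ρ + K + 1) + 1)) := by
  have hswap : ∑ b ∈ dyBlock j,
      ((((dyBlock i).filter fun a => (a * b / 2 ^ (i + ρ + 1 + K)) % 2 ^ t = 2 ^ t - 1).card : ℕ) : ℝ) =
      ∑ a ∈ dyBlock i,
      ((((dyBlock j).filter fun b => (a * b / 2 ^ (i + ρ + 1 + K)) % 2 ^ t = 2 ^ t - 1).card : ℕ) : ℝ) := by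
    simp only [Finset.card_filter]
    push_cast
    rw [Finset.sum_comm]
  rw [hswap]
  have hterm : ∀ a ∈ dyBlock i,
      ((((dyBlock j).filter fun b => (a * b / 2 ^ (i + ρ + 1 + K)) % 2 ^ t = 2 ^ t - 1).card : ℕ) : ℝ) ≤
        ((2 : ℝ) ^ j / 2 ^ (ρ + K + t) + 2) * (2 ^ (ρ + K + 1) + 1) := by
    intro a ha
    rw [mem_dyBlock] at ha
    have ha0 : 0 < a := lt_of_lt_of_le (Nat.two_pow_pos i) ha.1
    have h := card_filter_carry_le ha0 (i + ρ + 1 + K) t (N₁ := 2 ^ j) (N₂ := 2 ^ (j + 1))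
      (Nat.pow_le_pow_right (by norm_num) (Nat.le_succ j))
    rw [← dyBlock] at h
    refine h.trans ?_
    have haR : (2 : ℝ) ^ i ≤ a := by exact_mod_cast ha.1
    have haR' : (a : ℝ) ≤ 2 ^ (i + 1) := by exact_mod_cast ha.2.le
    have h1 : ((2 : ℝ) ^ (j + 1) - 2 ^ j) * a / 2 ^ (i + ρ + 1 + K + t) ≤ 2 ^ j / 2 ^ (ρ + K + t) := by
      rw [show ((2 : ℝ) ^ (j + 1) - 2 ^ j) = 2 ^ j by rw [pow_succ]; ring]
      rw [div_le_div_iff₀ (by positivity) (by positivity)]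
      calc (2 : ℝ) ^ j * a * 2 ^ (ρ + K + t) ≤ 2 ^ j * 2 ^ (i + 1) * 2 ^ (ρ + K + t) := by gcongr
        _ = 2 ^ j * 2 ^ (i + ρ + 1 + K + t) := by rw [mul_assoc, ← pow_add, ← pow_add]; ring_nf
    have h2 : (2 : ℝ) ^ (i + ρ + 1 + K) / a ≤ 2 ^ (ρ + K + 1) := by
      rw [div_le_iff₀ (by positivity)]
      calc (2 : ℝ) ^ (i + ρ + 1 + K) = 2 ^ (ρ + K + 1) * 2 ^ i := by rw [← pow_add]; ring_nf
        _ ≤ 2 ^ (ρ + K + 1) * a := by gcongr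
    push_cast at h1 ⊢
    have hA : 0 ≤ ((2 : ℝ) ^ (j + 1) - 2 ^ j) * a / 2 ^ (i + ρ + 1 + K + t) + 2 := by
      have : (0 : ℝ) ≤ (2 : ℝ) ^ (j + 1) - 2 ^ j := by
        rw [pow_succ]; linarith [pow_pos (show (0:ℝ) < 2 by norm_num) j]
      positivity
    exact mul_le_mul (by linarith) (by linarith) (by positivity) (by positivity)
  calc ∑ a ∈ dyBlock i,
        ((((dyBlock j).filter fun b => (a * b / 2 ^ (i + ρ + 1 + K)) % 2 ^ t = 2 ^ t - 1).card : ℕ) : ℝ)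
      ≤ ∑ _a ∈ dyBlock i, ((2 : ℝ) ^ j / 2 ^ (ρ + K + t) + 2) * (2 ^ (ρ + K + 1) + 1) := Finset.sum_le_sum hterm
    _ = 2 ^ i * (((2 : ℝ) ^ j / 2 ^ (ρ + K + t) + 2) * (2 ^ (ρ + K + 1) + 1)) := by
        rw [Finset.sum_const, card_dyBlock, nsmul_eq_mul]; push_cast; ring

end Literature.NumberTheory.LFunctions.MoebiusWalsh
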